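import Mathlib.Analysis.SpecialFunctions.SmoothTransition
import Literature.Geometry.Lorentzian.KerrSchildWaveCauchyProblem
import HarnessLib

/-!
# Reduction of the Kerr–Schild wave Cauchy problem to backgrounds which are flat outside
# spatially compact cylinders (localisation of the coefficients)

(family `gr`; namespace `Literature.Geometry.Lorentzian.KerrSchild`; proved infrastructure for
the discharge of the named fact `KerrSchild.waveCauchyProblem` of
`KerrSchildWaveCauchyProblem.lean`; this file introduces no named fact)

The named fact `KerrSchild.waveCauchyProblem` asserts, for every generalised Kerr–Schild
background `B` on `ℝ⁴` (`g⁻¹ = η⁻¹ − φ ℓ♯ ⊗ ℓ♯`, `KerrSchild.Background`) and all data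
`ψ₀, ψ₁ ∈ C_c^∞(ℝ³)`, a global smooth solution of `□_g u = ∑_μ ∂_μ (g^{μν} ∂_ν u) = 0` with these
Cauchy data on `{t = 0}`, supported in the Minkowski cone hull of the support of the data. Its
discharge by the energy method (Hörmander 1997, §6.3; Alinhac 2009, Ch. 7) wants coefficients all
of whose derivatives are bounded on every time slab `{|t| ≤ T}` (Hörmander 1997, (6.3.15)); a
general background only has a bounded profile. This file performs the standard localisation of
the coefficients (Hörmander 1997, §6.3, p. 108: "local results follow from global ones": replace
`L` by `χ L + (1 − χ) L(0)` with a cut-off `χ`; here `L(0) = □_η`), exploiting the finite speed of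
propagation built into the support clause of the fact, and thereby reduces the fact to
backgrounds which are flat outside a bounded cylinder of every slab:

* `KerrSchild.Background.profileCutoff` — the class of backgrounds is closed under multiplying
  the profile `φ` by a smooth cut-off `0 ≤ χ ≤ 1` (the metric `η + χφ ℓ ⊗ ℓ` is again of
  Kerr–Schild form with the same null covector);
* `KerrSchild.Background.coneCutoff R` — the smooth cut-off
  `χ_R(t, x⃗) = smoothTransition (2(R+1)² + 2t² + 1 − ‖x⃗‖²)`, equal to `1` on the solid cone
  `{‖x⃗‖ ≤ R + 1 + |t|}` and to `0` on `{‖x⃗‖ ≥ 2R + 3 + 2|t|}` (`R ≥ 0`);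
* `KerrSchild.Background.IsTame B` — on every slab `{|t| ≤ T}` the profile vanishes outside a
  bounded cylinder `{‖x⃗‖ < ρ}`, so that `g = η` there; the cut-off background
  `B.profileCutoff (coneCutoff R) …` is tame (`isTame_coneCutoffBackground`);
* `KerrSchild.Background.waveOperator_coneCutoff_eq`,
  `KerrSchild.Background.waveOperator_eq_zero_of_coneCutoff` — **localisation of the equation**:
  for a function `u` vanishing outside the solid cone `{‖x⃗‖ ≤ R + |t|}` (e.g. outside the
  Minkowski domain of influence of data supported in `{‖y‖ ≤ R}`), the wave operators of `B` and
  of the cut-off background `η + χ_R φ ℓ ⊗ ℓ` agree on `u` at every point of `ℝ⁴` — on a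
  neighbourhood of the cone `χ_R = 1`, elsewhere `u` vanishes locally — by locality of the
  divergence-form operator in the coefficients and in the function
  (`waveOperator_congr_of_eventuallyEq`, `waveOperator_eq_zero_of_eventuallyEq_zero`); so a global
  solution on the cut-off background with the domain-of-influence property solves the original
  equation everywhere;
* `KerrSchild.waveCauchyProblem_of_tame` — **the reduction**: if the statement of
  `waveCauchyProblem` holds for every *tame* background, it holds for every background (solve on
  the tame cut-off background adapted to the support of the data and apply the localisation).
  The tame existence statement is the remaining (theory-sized) proof obligation of
  `KerrSchild.waveCauchyProblem` — it is logically equivalent to it, the converse being the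
  trivial specialisation — and is therefore taken as an explicit hypothesis here, not vendored
  as a named fact of its own (D-0026: a decomposition child must be a distinct published
  result). Its intended proof is the energy method on slabs (a-priori estimate:
  `KerrSchild.Background.lintegral_energy_estimate`, `KerrSchildEnergyEstimate.lean`; domain of
  dependence: `KerrSchild.Background.fderiv_eq_zero_of_weight`, `KerrSchildLocalEnergy.lean`;
  existence of smooth solutions: Alinhac 2009, Thm. 7.11, or Hörmander 1997, pp. 107–108).

## References

* L. Hörmander, *Lectures on nonlinear hyperbolic differential equations*, Springer 1997, §6.3,
  pp. 106–108 (energy estimates, existence and the localisation remark) (key `Hormander1997`).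
* S. Alinhac, *Hyperbolic partial differential equations*, Springer 2009, Thm. 7.9 (finite speed
  of propagation), Thm. 7.11 (existence of smooth solutions) (key `AlinhacHPDE2009`).
* C. Bär, N. Ginoux, F. Pfäffle, *Wave equations on Lorentzian manifolds and quantization*, EMS
  2007 (arXiv:0806.1036), Thm. 3.2.11 (key `BarGinouxPfaffle2007`).
* Y. Choquet-Bruhat, S. Cotsakis, J. Geom. Phys. 43 (2002), Thm. 2.1 (key
  `ChoquetbruhatCotsakis2002`); R. P. Kerr, A. Schild, 1965, §2 (key `KerrSchild1965`).
-/

noncomputable section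

open Set Filter Metric
open scoped ContDiff Topology

namespace Literature.Geometry.Lorentzian

namespace KerrSchild

/-! ### Locality of the divergence-form wave operator in the function -/

/-- **The wave operator is local in the function**: if `u` vanishes on a neighbourhood of `x`,
then `□_G u (x) = 0` for every coefficient field `G`. [folklore] -/
theorem waveOperator_eq_zero_of_eventuallyEq_zero {G : E4 → Fin 4 → Fin 4 → ℝ} {u : E4 → ℝ}
    {x : E4} (h : u =ᶠ[𝓝 x] 0) : waveOperator G u x = 0 := by
  have h' : ∀ᶠ y in 𝓝 x, u =ᶠ[𝓝 y] (0 : E4 → ℝ) := h.eventually_nhds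
  have hinner : ∀ μ : Fin 4,
      (fun y ↦ ∑ ν, G y μ ν * fderiv ℝ u y (E4.basisVector ν)) =ᶠ[𝓝 x] fun _ ↦ (0 : ℝ) := by
    intro μ
    filter_upwards [h'] with y hy
    have hfd : fderiv ℝ u y = 0 := by
      rw [hy.fderiv_eq]
      exact fderiv_const_apply 0
    simp [hfd]
  unfold waveOperator
  refine Finset.sum_eq_zero fun μ _ ↦ ?_
  rw [(hinner μ).fderiv_eq, fderiv_const_apply]
  rfl

namespace Background

/-! ### Cutting off the profile of a background -/

/-- On a background, `φ l^μ l^ν = η^{μν} − g^{μν}`. [cite: KerrSchild1965, §2] -/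
theorem φ_mul_l_mul_l (B : Background) (x : E4) (μ ν : Fin 4) :
    B.φ x * B.l x μ * B.l x ν = Kerr.etaComp μ ν - B.inverseMetric x μ ν := by
  simp [Background.inverseMetric, KerrSchild.inverseMetric]

/-- **Backgrounds are closed under smooth cut-offs of the profile.** For a background
`g⁻¹ = η⁻¹ − φ ℓ♯ ⊗ ℓ♯` and a smooth `χ : ℝ⁴ → [0, 1]`, the metric `η + χφ ℓ ⊗ ℓ` is again a
generalised Kerr–Schild background with the same null vector and the same bound: `0 ≤ χφ ≤ Φ`,
`ℓ` is null and normalised wherever `χφ ≠ 0`, and the components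
`η^{μν} − χφ l^μ l^ν = η^{μν} − χ (η^{μν} − g^{μν})` are smooth. This is the localisation
`χ L + (1 − χ) L(0)` of Hörmander 1997, §6.3 (p. 108) for `L = □_g`, `L(0) = □_η`, which stays
inside the Kerr–Schild class. [cite: Hormander1997, §6.3 p. 108] -/
def profileCutoff (B : Background) (χ : E4 → ℝ) (hχ : ContDiff ℝ ∞ χ) (hχ0 : ∀ x, 0 ≤ χ x)
    (hχ1 : ∀ x, χ x ≤ 1) : Background where
  φ x := χ x * B.φ x
  l := B.l
  bound := B.bound
  φ_nonneg x := mul_nonneg (hχ0 x) (B.φ_nonneg x)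
  φ_le x := (mul_le_of_le_one_left (B.φ_nonneg x) (hχ1 x)).trans (B.φ_le x)
  null x hx := B.null x (right_ne_zero_of_mul hx)
  normalised x hx := B.normalised x (right_ne_zero_of_mul hx)
  contDiff_inverseMetric μ ν := by
    have h : (fun x ↦ KerrSchild.inverseMetric (fun x ↦ χ x * B.φ x) B.l x μ ν) =
        fun x ↦ Kerr.etaComp μ ν - χ x * (Kerr.etaComp μ ν - B.inverseMetric x μ ν) := by
      funext x
      rw [← B.φ_mul_l_mul_l x μ ν]
      simp only [KerrSchild.inverseMetric]
      ring
    rw [h]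
    exact contDiff_const.sub (hχ.mul (contDiff_const.sub (B.contDiff_inverseMetric μ ν)))

/-- The profile of the cut-off background is `χφ`. [cite: Hormander1997, §6.3 p. 108] -/
@[simp]
theorem profileCutoff_φ (B : Background) (χ : E4 → ℝ) (hχ : ContDiff ℝ ∞ χ)
    (hχ0 : ∀ x, 0 ≤ χ x) (hχ1 : ∀ x, χ x ≤ 1) (x : E4) :
    (B.profileCutoff χ hχ hχ0 hχ1).φ x = χ x * B.φ x := rfl

/-- The null vector of the cut-off background is unchanged. [cite: Hormander1997, §6.3 p. 108] -/
@[simp]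
theorem profileCutoff_l (B : Background) (χ : E4 → ℝ) (hχ : ContDiff ℝ ∞ χ)
    (hχ0 : ∀ x, 0 ≤ χ x) (hχ1 : ∀ x, χ x ≤ 1) : (B.profileCutoff χ hχ hχ0 hχ1).l = B.l := rfl

/-- **Where `χ = 1` the cut-off background has the original inverse metric.**
[cite: Hormander1997, §6.3 p. 108] -/
theorem profileCutoff_inverseMetric_of_eq_one (B : Background) {χ : E4 → ℝ}
    (hχ : ContDiff ℝ ∞ χ) (hχ0 : ∀ x, 0 ≤ χ x) (hχ1 : ∀ x, χ x ≤ 1) {x : E4} (hx : χ x = 1)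
    (μ ν : Fin 4) : (B.profileCutoff χ hχ hχ0 hχ1).inverseMetric x μ ν = B.inverseMetric x μ ν := by
  simp [Background.inverseMetric, KerrSchild.inverseMetric, hx]

/-- Where `χ = 0` the cut-off background is flat: `g^{μν} = η^{μν}`.
[cite: Hormander1997, §6.3 p. 108] -/
theorem profileCutoff_inverseMetric_of_eq_zero (B : Background) {χ : E4 → ℝ}
    (hχ : ContDiff ℝ ∞ χ) (hχ0 : ∀ x, 0 ≤ χ x) (hχ1 : ∀ x, χ x ≤ 1) {x : E4} (hx : χ x = 0)
    (μ ν : Fin 4) : (B.profileCutoff χ hχ hχ0 hχ1).inverseMetric x μ ν = Kerr.etaComp μ ν := by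
  simp [Background.inverseMetric, KerrSchild.inverseMetric, hx]

/-! ### The cone cut-off -/

/-- The **cone cut-off** `χ_R(x) = smoothTransition (2(R+1)² + 2 (x⁰)² + 1 − ‖x⃗‖²)`: a smooth
function `ℝ⁴ → [0, 1]` equal to `1` on the solid cone `{‖x⃗‖ ≤ R + 1 + |x⁰|}` and to `0` on
`{‖x⃗‖ ≥ 2R + 3 + 2|x⁰|}` (for `R ≥ 0`), built from Mathlib's `Real.smoothTransition` and the
polynomial `2(R+1)² + 2t² + 1 − ‖x⃗‖²` (no square roots, so that smoothness is immediate).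
[folklore] -/
def coneCutoff (R : ℝ) (x : E4) : ℝ :=
  Real.smoothTransition (2 * (R + 1) ^ 2 + 2 * (x 0) ^ 2 + 1 - ‖E4.spatial x‖ ^ 2)

/-- `0 ≤ χ_R`. [folklore] -/
theorem coneCutoff_nonneg (R : ℝ) (x : E4) : 0 ≤ coneCutoff R x :=
  Real.smoothTransition.nonneg _

/-- `χ_R ≤ 1`. [folklore] -/
theorem coneCutoff_le_one (R : ℝ) (x : E4) : coneCutoff R x ≤ 1 :=
  Real.smoothTransition.le_one _

/-- `χ_R` is smooth on `ℝ⁴`. [folklore] -/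
theorem contDiff_coneCutoff (R : ℝ) : ContDiff ℝ ∞ (coneCutoff R) := by
  unfold coneCutoff
  refine Real.smoothTransition.contDiff.comp ?_
  refine (((contDiff_const.add (contDiff_const.mul ((Kerr.contDiff_coord 0).pow 2))).add
    contDiff_const).sub ?_)
  exact (contDiff_norm_sq ℝ).comp E4.spatial.contDiff

/-- **`χ_R = 1` on the solid cone `{‖x⃗‖ ≤ R + 1 + |x⁰|}`.** [folklore] -/
theorem coneCutoff_eq_one {R : ℝ} {x : E4} (hx : ‖E4.spatial x‖ ≤ R + 1 + |x 0|) :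
    coneCutoff R x = 1 := by
  refine Real.smoothTransition.one_of_one_le ?_
  have h0 : 0 ≤ ‖E4.spatial x‖ := norm_nonneg _
  have h1 : ‖E4.spatial x‖ ^ 2 ≤ (R + 1 + |x 0|) ^ 2 := pow_le_pow_left₀ h0 hx 2
  have h2 : (R + 1 + |x 0|) ^ 2 ≤ 2 * (R + 1) ^ 2 + 2 * (x 0) ^ 2 := by
    rw [← sq_abs (x 0)]
    nlinarith [sq_nonneg (R + 1 - |x 0|)]
  linarith

/-- **`χ_R = 0` outside `{‖x⃗‖ < 2R + 3 + 2|x⁰|}`** (for `R ≥ 0`). [folklore] -/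
theorem coneCutoff_eq_zero {R : ℝ} (hR : 0 ≤ R) {x : E4}
    (hx : 2 * R + 3 + 2 * |x 0| ≤ ‖E4.spatial x‖) : coneCutoff R x = 0 := by
  refine Real.smoothTransition.zero_of_nonpos ?_
  have ha : 0 ≤ |x 0| := abs_nonneg _
  have h0 : 0 ≤ 2 * R + 3 + 2 * |x 0| := by positivity
  have h1 : (2 * R + 3 + 2 * |x 0|) ^ 2 ≤ ‖E4.spatial x‖ ^ 2 := pow_le_pow_left₀ h0 hx 2
  have h2 : 2 * (R + 1) ^ 2 + 2 * (x 0) ^ 2 + 1 ≤ (2 * R + 3 + 2 * |x 0|) ^ 2 := by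
    rw [← sq_abs (x 0)]
    nlinarith
  linarith

/-! ### Tame backgrounds -/

/-- A background is **tame** if on every time slab `{|x⁰| ≤ T}` its profile vanishes outside a
bounded cylinder `{‖x⃗‖ < ρ}`: there `g = η`, so on each slab the coefficients `g^{μν}` are
constant outside a compact set and all their derivatives are bounded — the hypothesis under which
the energy method is run (Hörmander 1997, §6.3, (6.3.15): "all derivatives of the coefficients
are bounded in `[0, T] × ℝⁿ`"). [cite: Hormander1997, §6.3 (6.3.15)] -/
def IsTame (B : Background) : Prop :=
  ∀ T : ℝ, ∃ ρ : ℝ, ∀ x : E4, |x 0| ≤ T → ρ ≤ ‖E4.spatial x‖ → B.φ x = 0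

/-- On a tame background, on each slab the inverse metric is `η⁻¹` outside a bounded cylinder.
[cite: Hormander1997, §6.3 (6.3.15)] -/
theorem IsTame.exists_inverseMetric_eq_eta {B : Background} (hB : B.IsTame) (T : ℝ) :
    ∃ ρ : ℝ, ∀ x : E4, |x 0| ≤ T → ρ ≤ ‖E4.spatial x‖ →
      ∀ μ ν, B.inverseMetric x μ ν = Kerr.etaComp μ ν := by
  obtain ⟨ρ, hρ⟩ := hB T
  exact ⟨ρ, fun x hT hx μ ν ↦ inverseMetric_of_eq_zero B.l (hρ x hT hx) μ ν⟩

/-- The Minkowski background is tame. [cite: Hormander1997, §6.3 (6.3.15)] -/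
theorem isTame_minkowski : minkowski.IsTame :=
  fun _ ↦ ⟨0, fun _ _ _ ↦ rfl⟩

/-- **The cone cut-off of any background is tame**: on `{|x⁰| ≤ T}` the profile `χ_R φ` vanishes
for `‖x⃗‖ ≥ 2R + 3 + 2T` (`R ≥ 0`). [cite: Hormander1997, §6.3 p. 108] -/
theorem isTame_coneCutoffBackground (B : Background) {R : ℝ} (hR : 0 ≤ R) :
    (B.profileCutoff (coneCutoff R) (contDiff_coneCutoff R) (coneCutoff_nonneg R)
      (coneCutoff_le_one R)).IsTame := by
  intro T
  refine ⟨2 * R + 3 + 2 * T, fun x hT hx ↦ ?_⟩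
  rw [profileCutoff_φ, coneCutoff_eq_zero hR (by linarith), zero_mul]

end Background

/-! ### The reduction to tame backgrounds -/

/-- **Support in the Minkowski domain of influence of a ball lies in a solid cone.** If `u`
vanishes at every `x` with `|x⁰| < ‖x⃗ − y‖` for all `y` in a set `K ⊆ {‖y‖ ≤ R}`, then `u`
vanishes at every `x` with `R + |x⁰| < ‖x⃗‖` (triangle inequality:
`‖x⃗ − y‖ ≥ ‖x⃗‖ − ‖y‖ ≥ ‖x⃗‖ − R > |x⁰|`). [folklore] -/
theorem eq_zero_of_forall_lt_dist {K : Set E3} {R : ℝ} (hK : ∀ y ∈ K, ‖y‖ ≤ R) {u : E4 → ℝ}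
    (hsupp : ∀ x : E4, (∀ y ∈ K, |x 0| < dist (E4.spatial x) y) → u x = 0) {x : E4}
    (hx : R + |x 0| < ‖E4.spatial x‖) : u x = 0 :=
  hsupp x fun z hz ↦ by
    calc |x 0| < ‖E4.spatial x‖ - R := by linarith
      _ ≤ ‖E4.spatial x‖ - ‖z‖ := by linarith [hK z hz]
      _ ≤ dist (E4.spatial x) z := by
          rw [dist_eq_norm]
          exact norm_sub_norm_le _ _

namespace Background

/-- **Localisation of the equation (pointwise form of Hörmander's remark).** Let `B` be a
background, `R` a radius and `u : ℝ⁴ → ℝ` a function vanishing at every point of the open set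
`{R + |x⁰| < ‖x⃗‖}` (the complement of the solid cone over the ball `{‖y‖ ≤ R} ⊆ {t = 0}`). Then
at every point of `ℝ⁴` the divergence-form wave operators of the cut-off background
`η + χ_R φ ℓ ⊗ ℓ` (`profileCutoff`, `coneCutoff`) and of `B` agree on `u`: at a point of the open
cone `{‖x⃗‖ < R + 1 + |x⁰|}` the two coefficient fields coincide on a neighbourhood (`χ_R = 1`
there, `coneCutoff_eq_one`), and at any other point `u` vanishes on a neighbourhood, where both
operators give `0` (locality in the coefficients and in the function,
`waveOperator_congr_of_eventuallyEq`, `waveOperator_eq_zero_of_eventuallyEq_zero`). This is the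
localisation `χ L + (1 − χ) L(0)` of Hörmander 1997, §6.3, p. 108 ("local results follow from
global ones"), run with the finite speed of propagation. [cite: Hormander1997, §6.3 p. 108] -/
theorem waveOperator_coneCutoff_eq (B : Background) {R : ℝ} {u : E4 → ℝ}
    (hu : ∀ x : E4, R + |x 0| < ‖E4.spatial x‖ → u x = 0) (x : E4) :
    waveOperator (B.profileCutoff (coneCutoff R) (contDiff_coneCutoff R) (coneCutoff_nonneg R)
        (coneCutoff_le_one R)).inverseMetric u x = waveOperator B.inverseMetric u x := by
  have hc0 : Continuous fun y : E4 ↦ y 0 := (Kerr.contDiff_coord 0 (n := ∞)).continuous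
  have hcn : Continuous fun y : E4 ↦ ‖E4.spatial y‖ := continuous_norm.comp E4.spatial.continuous
  by_cases hx : ‖E4.spatial x‖ < R + 1 + |x 0|
  · -- near `x` the two backgrounds have the same coefficients
    refine waveOperator_congr_of_eventuallyEq (fun μ ν ↦ ?_) u
    have hopen : IsOpen {y : E4 | ‖E4.spatial y‖ < R + 1 + |y 0|} :=
      isOpen_lt hcn ((continuous_const.add continuous_const).add (continuous_abs.comp hc0))
    filter_upwards [hopen.mem_nhds hx] with y hy
    exact B.profileCutoff_inverseMetric_of_eq_one _ _ _ (coneCutoff_eq_one (le_of_lt hy)) μ ν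
  · -- near `x` the function vanishes identically, so both sides vanish
    have hu0 : u =ᶠ[𝓝 x] 0 := by
      have hopen : IsOpen {y : E4 | R + |y 0| < ‖E4.spatial y‖} :=
        isOpen_lt (continuous_const.add (continuous_abs.comp hc0)) hcn
      have hxmem : R + |x 0| < ‖E4.spatial x‖ := by linarith [not_lt.mp hx]
      filter_upwards [hopen.mem_nhds hxmem] with y hy
      exact hu y hy
    rw [waveOperator_eq_zero_of_eventuallyEq_zero hu0,
      waveOperator_eq_zero_of_eventuallyEq_zero hu0]

/-- **A global solution on the cut-off background with the domain-of-influence property is a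
global solution on the original background.** If the data live in `K ⊆ {‖y‖ ≤ R}`, `u` vanishes
outside the Minkowski domain of influence of `{0} × K` and `u` solves the wave equation of the
cut-off background `η + χ_R φ ℓ ⊗ ℓ` on `ℝ⁴`, then `u` solves the wave equation of `B` on `ℝ⁴`.
[cite: Hormander1997, §6.3 p. 108] -/
theorem waveOperator_eq_zero_of_coneCutoff (B : Background) {R : ℝ} {K : Set E3}
    (hK : ∀ y ∈ K, ‖y‖ ≤ R) {u : E4 → ℝ}
    (hsupp : ∀ x : E4, (∀ y ∈ K, |x 0| < dist (E4.spatial x) y) → u x = 0)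
    (hsol : ∀ x : E4, waveOperator (B.profileCutoff (coneCutoff R) (contDiff_coneCutoff R)
      (coneCutoff_nonneg R) (coneCutoff_le_one R)).inverseMetric u x = 0) (x : E4) :
    waveOperator B.inverseMetric u x = 0 := by
  rw [← B.waveOperator_coneCutoff_eq (fun y hy ↦ eq_zero_of_forall_lt_dist hK hsupp hy) x]
  exact hsol x

end Background

/-- **Reduction of the Kerr–Schild wave Cauchy problem to tame backgrounds.** If the Cauchy
problem with domain of dependence — the statement of `KerrSchild.waveCauchyProblem`:
`u ∈ C^∞(ℝ⁴)`, `∑_μ ∂_μ (∑_ν g^{μν} ∂_ν u) = 0`, Cauchy data `(ψ₀, ψ₁)` on `{t = 0}`, `u = 0`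
outside the Minkowski domain of influence of the support of the data — is solvable on every
**tame** background (`Background.IsTame`: on each slab `{|t| ≤ T}` the metric is `η` outside a
bounded cylinder, so that all derivatives of the coefficients are bounded on slabs, the setting
of the energy-method existence theory, Hörmander 1997, §6.3, (6.3.15)–(6.3.18)' and pp. 107–108;
Alinhac 2009, Thm. 7.11), then it is solvable on every background: for data supported in
`{‖y‖ ≤ R}` solve on the cut-off background `η + χ_R φ ℓ ⊗ ℓ` (`Background.profileCutoff`,
`Background.coneCutoff`), which is tame (`Background.isTame_coneCutoffBackground`), and apply
`Background.waveOperator_eq_zero_of_coneCutoff`. Hörmander 1997, §6.3, p. 108 ("local results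
follow from global ones"). The tame existence statement is deliberately *not* vendored as a
separate named fact: it is logically equivalent to `KerrSchild.waveCauchyProblem` (the converse
direction is the trivial specialisation), so it is the remaining proof obligation of that fact,
not a distinct published result. [cite: Hormander1997, §6.3 p. 108] -/
theorem waveCauchyProblem_of_tame
    (h : ∀ B : Background, B.IsTame → ∀ ψ₀ ψ₁ : E3 → ℝ, ContDiff ℝ ∞ ψ₀ → ContDiff ℝ ∞ ψ₁ →
      HasCompactSupport ψ₀ → HasCompactSupport ψ₁ →
      ∃ u : E4 → ℝ, ContDiff ℝ ∞ u ∧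
        (∀ x : E4, waveOperator B.inverseMetric u x = 0) ∧
        (∀ y : E3, u (E4.ofTimeSpace 0 y) = ψ₀ y ∧
          fderiv ℝ u (E4.ofTimeSpace 0 y) (E4.basisVector 0) = ψ₁ y) ∧
        (∀ x : E4, (∀ y ∈ tsupport ψ₀ ∪ tsupport ψ₁, |x 0| < dist (E4.spatial x) y) → u x = 0)) :
    waveCauchyProblem := by
  intro B ψ₀ ψ₁ hψ₀ hψ₁ hc₀ hc₁
  -- a radius for the support of the data
  obtain ⟨R, hR0, hR⟩ : ∃ R : ℝ, 0 ≤ R ∧ ∀ y ∈ tsupport ψ₀ ∪ tsupport ψ₁, ‖y‖ ≤ R := by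
    have hK : IsCompact (tsupport ψ₀ ∪ tsupport ψ₁) := hc₀.isCompact.union hc₁.isCompact
    obtain ⟨R, hR⟩ := hK.isBounded.exists_norm_le
    exact ⟨max R 0, le_max_right _ _, fun y hy ↦ (hR y hy).trans (le_max_left _ _)⟩
  -- solve on the (tame) cut-off background and transport the solution
  obtain ⟨u, hu, hsol, hdata, hsupp⟩ :=
    h _ (B.isTame_coneCutoffBackground hR0) ψ₀ ψ₁ hψ₀ hψ₁ hc₀ hc₁
  exact ⟨u, hu, B.waveOperator_eq_zero_of_coneCutoff hR hsupp hsol, hdata, hsupp⟩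

end KerrSchild

end Literature.Geometry.Lorentzian

end
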